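import Summits.KontsevichZagierPeriods.KontsevichZagierPeriods.Theorems.RootDecompWalshStrataBall4Chart
import Summits.KontsevichZagierPeriods.KontsevichZagierPeriods.Theorems.RootDecompWalshStrataConeBaker

/-!
# The 4-ball specimen, part 2/4: Newton–Leibniz along the radial coordinate `w₃`

Route `RootDecompWalshStrata` (cell decomp-kz, lens 4, gen 11), support toward `QuadricSignKernel`
(item stmt-KontsevichZagierPeriods-25393).  The source domain `A₁` of part 1 is the OPEN BAND
`0 < w₃ < b(u)`, `b(u) = √((1 − u₀² − u₁²)/((1 − u₂)² + u₂²))`, over the quarter-cylinder Walsh 3-cell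
`Z = (0,1)³ ∩ {u₀² + u₁² < 1}` (`cylPoly` of the cone specimen).  Rule (3) along `w₃` with the primitive
`q·w₃²/2`, then rule (1a) (opening the fibres), gives
`[A₁, q·w₃] − [Z, q(1 − u₀² − u₁²)/(2((1 − u₂)² + u₂²))] ∈ KZ.relations`,
hence with part 1 `[ball-orthant cell, q] ≡ [Z, q(1 − u₀² − u₁²)/(2((1 − u₂)² + u₂²))]` — a RATIONAL
weight on a Walsh 3-cell (`4 → 3`).  0 sorry.  [KontsevichZagier2001 §1.2 rules (1), (3)]
-/

noncomputable section

open Literature.NumberTheory.Transcendental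
open MeasureTheory Set
open MvPolynomial (aeval X C)
open Literature.ModelTheory.ExponentialFields (IsSemialgebraic isSemialgebraic_setOf_eval_pos
  isSemialgebraic_setOf_eval_lt continuous_aeval_real)
open Summit.KontsevichZagierPeriods.RootDecompWalshStrata.WalshSpanProof (isSemialgebraic_cubeSet
  isBounded_cubeSet cellRep cellRep_domain cellRep_integrand)
open Summit.KontsevichZagierPeriods.RootDecompWalshStrata.ConeSpecimen (cubeCell_subset_Icc cylPoly
  aeval_cylPoly)

namespace Summit.KontsevichZagierPeriods.RootDecompWalshStrata.Ball4

/-! #### The quarter-cylinder base `Z` and the descended representation on it -/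

/-- `(1 − v)² + v² > 0`. [folklore] -/
private theorem gq_pos (v : ℝ) : 0 < (1 - v) ^ 2 + v ^ 2 := by nlinarith [sq_nonneg (1 - 2 * v)]

/-- `(1 − v)² + v² ≥ 1/2`. [folklore] -/
theorem half_le_gq (v : ℝ) : 1 / 2 ≤ (1 - v) ^ 2 + v ^ 2 := by nlinarith [sq_nonneg (1 - 2 * v)]

/-- The quarter-cylinder Walsh 3-cell `Z = (0,1)³ ∩ {u₀² + u₁² < 1}`. -/
def cylSet : Set (Fin 3 → ℝ) := {u | (∀ j, 0 < u j ∧ u j < 1) ∧ 0 < aeval u cylPoly}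

/-- `Z` is `ℚ`-semialgebraic. [BCR1998 §2.1] -/
theorem isSemialgebraic_cylSet : IsSemialgebraic ℚ cylSet := (cellRep cylPoly 0).isSemialgebraic_domain

/-- `Z ⊆ [0,1]³`. [folklore] -/
theorem cylSet_subset_Icc : cylSet ⊆ Icc 0 1 := cubeCell_subset_Icc cylPoly

/-- The denominator `(1 − u₂)² + u₂²` does not vanish. [folklore] -/
theorem aeval_den_ne_zero (u : Fin 3 → ℝ) :
    aeval u (((1 - X 2) ^ 2 + X 2 ^ 2 : MvPolynomial (Fin 3) ℚ)) ≠ 0 := by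
  simpa using (gq_pos (u 2)).ne'

/-- `[Z, q(1 − u₀² − u₁²)/(2((1 − u₂)² + u₂²))]`: the representation after the first descent (a
rational weight on the quarter-cylinder cell). [KontsevichZagier2001 §1.1] -/
def cylWRep (q : ℚ) : KZ.IntegralRep 3 where
  domain := cylSet
  integrand u := (q : ℝ) * (1 - u 0 ^ 2 - u 1 ^ 2) / (2 * ((1 - u 2) ^ 2 + u 2 ^ 2))
  isSemialgebraic_domain := isSemialgebraic_cylSet
  isSemialgebraicFunOn_integrand :=
    (isSemialgebraicFunOn_aeval_div_aeval isSemialgebraic_cylSet (C q * (1 - X 0 ^ 2 - X 1 ^ 2))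
      (2 * ((1 - X 2) ^ 2 + X 2 ^ 2)) fun u _ => by
        simpa using (gq_pos (u 2)).ne').congr fun u _ => by simp
  integrableOn := by
    refine (ContinuousOn.integrableOn_compact isCompact_Icc ?_).mono_set cylSet_subset_Icc
    have hc : Continuous fun u : Fin 3 → ℝ =>
        (q : ℝ) * (1 - u 0 ^ 2 - u 1 ^ 2) / (2 * ((1 - u 2) ^ 2 + u 2 ^ 2)) := by
      refine Continuous.div ?_ ?_ fun u => ?_
      · exact continuous_const.mul ((continuous_const.sub ((continuous_apply 0).pow 2)).sub
          ((continuous_apply 1).pow 2))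
      · exact continuous_const.mul (((continuous_const.sub (continuous_apply 2)).pow 2).add
          ((continuous_apply 2).pow 2))
      · exact (mul_pos two_pos (gq_pos (u 2))).ne'
    exact hc.continuousOn

/-- The domain of the descended representation. [definition] -/
@[simp] theorem cylWRep_domain (q : ℚ) : (cylWRep q).domain = cylSet := rfl

/-- The integrand of the descended representation. [definition] -/
@[simp] theorem cylWRep_integrand (q : ℚ) (u : Fin 3 → ℝ) :
    (cylWRep q).integrand u = (q : ℝ) * (1 - u 0 ^ 2 - u 1 ^ 2) / (2 * ((1 - u 2) ^ 2 + u 2 ^ 2)) :=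
  rfl

/-! #### The upper edge `b(u) = √((1 − u₀² − u₁²)/((1 − u₂)² + u₂²))` and the band -/

/-- The upper edge of the band. -/
def bEdge (u : Fin 3 → ℝ) : ℝ := √((1 - u 0 ^ 2 - u 1 ^ 2) / ((1 - u 2) ^ 2 + u 2 ^ 2))

/-- The upper edge is `ℚ`-semialgebraic on `Z` (square root of a rational function).
[BCR1998 §2.2] -/
theorem isSemialgebraicFunOn_bEdge : IsSemialgebraicFunOn ℚ cylSet bEdge :=
  (IsSemialgebraicFunOn.sqrt_holds
    (isSemialgebraicFunOn_aeval_div_aeval isSemialgebraic_cylSet (1 - X 0 ^ 2 - X 1 ^ 2)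
      ((1 - X 2) ^ 2 + X 2 ^ 2) fun u _ => aeval_den_ne_zero u)).congr fun u _ => by
    simp [bEdge]

/-- On `Z` the radicand is positive. [folklore] -/
theorem radicand_pos {u : Fin 3 → ℝ} (hu : u ∈ cylSet) :
    0 < (1 - u 0 ^ 2 - u 1 ^ 2) / ((1 - u 2) ^ 2 + u 2 ^ 2) :=
  div_pos (by simpa using hu.2) (gq_pos (u 2))

/-- On `Z`, `b(u)² = (1 − u₀² − u₁²)/((1 − u₂)² + u₂²)`. [folklore] -/
theorem bEdge_sq {u : Fin 3 → ℝ} (hu : u ∈ cylSet) :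
    bEdge u ^ 2 = (1 - u 0 ^ 2 - u 1 ^ 2) / ((1 - u 2) ^ 2 + u 2 ^ 2) :=
  Real.sq_sqrt (radicand_pos hu).le

/-- On `Z`, `b(u) < 2`. [folklore] -/
theorem bEdge_lt_two {u : Fin 3 → ℝ} (hu : u ∈ cylSet) : bEdge u < 2 := by
  refine (Real.sqrt_lt' two_pos).2 ((div_lt_iff₀ (gq_pos (u 2))).2 ?_)
  have h0 := hu.1 0
  have h1 := hu.1 1
  nlinarith [half_le_gq (u 2), sq_nonneg (u 0), sq_nonneg (u 1)]

/-- Membership in the source domain `A₁` in band form: `A₁` is the open band `0 < w₃ < b` over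
`Z`. [folklore] -/
theorem mem_srcSet_iff_init (z : Fin 4 → ℝ) :
    z ∈ srcSet ↔ Fin.init z ∈ cylSet ∧ 0 < z (Fin.last 3) ∧ z (Fin.last 3) < bEdge (Fin.init z) := by
  rw [mem_srcSet]
  have hG := gq_pos (z 2)
  have key : z 3 ^ 2 * ((1 - z 2) ^ 2 + z 2 ^ 2) = (z 3 * (1 - z 2)) ^ 2 + (z 3 * z 2) ^ 2 := by
    ring
  have hcyl : Fin.init z ∈ cylSet ↔
      ((0 < z 0 ∧ z 0 < 1) ∧ (0 < z 1 ∧ z 1 < 1) ∧ (0 < z 2 ∧ z 2 < 1)) ∧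
        0 < 1 - z 0 ^ 2 - z 1 ^ 2 := by
    simp only [cylSet, mem_setOf_eq, aeval_cylPoly, Fin.init]
    constructor
    · rintro ⟨hu, hc⟩
      exact ⟨⟨hu 0, hu 1, hu 2⟩, hc⟩
    · rintro ⟨⟨h0, h1, h2⟩, hc⟩
      refine ⟨fun j => ?_, hc⟩
      fin_cases j
      · exact h0
      · exact h1
      · exact h2
  have hb : bEdge (Fin.init z) = √((1 - z 0 ^ 2 - z 1 ^ 2) / ((1 - z 2) ^ 2 + z 2 ^ 2)) := rfl
  have hl : z (Fin.last 3) = z 3 := rfl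
  rw [hcyl, hb, hl]
  constructor
  · rintro ⟨h0, h1, h2, h3, hP⟩
    have hc : 0 < 1 - z 0 ^ 2 - z 1 ^ 2 := by
      nlinarith [sq_nonneg (z 3 * (1 - z 2)), sq_nonneg (z 3 * z 2)]
    refine ⟨⟨⟨h0, h1, h2⟩, hc⟩, h3, (Real.lt_sqrt h3.le).2 ((lt_div_iff₀ hG).2 ?_)⟩
    rw [key]
    linarith
  · rintro ⟨⟨⟨h0, h1, h2⟩, hc⟩, h3, hlt⟩
    have hsq : z 3 ^ 2 < (1 - z 0 ^ 2 - z 1 ^ 2) / ((1 - z 2) ^ 2 + z 2 ^ 2) :=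
      (Real.lt_sqrt h3.le).1 hlt
    have hsq' : z 3 ^ 2 * ((1 - z 2) ^ 2 + z 2 ^ 2) < 1 - z 0 ^ 2 - z 1 ^ 2 :=
      (lt_div_iff₀ hG).1 hsq
    refine ⟨h0, h1, h2, h3, ?_⟩
    rw [key] at hsq'
    linarith

/-- The closed band `0 ≤ w₃ ≤ b(u)` over `Z` lies in `[0,2]⁴`. [folklore] -/
theorem band_cylSet_subset_Icc : KZlog.band cylSet (fun _ => (0:ℝ)) bEdge ⊆ Icc 0 2 := by
  intro z hz
  rw [KZlog.mem_band] at hz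
  obtain ⟨hu, h0, h1⟩ := hz
  have hlt := bEdge_lt_two hu
  have hu' := hu.1
  refine ⟨fun j => ?_, fun j => ?_⟩
  · fin_cases j
    · exact (hu' 0).1.le
    · exact (hu' 1).1.le
    · exact (hu' 2).1.le
    · exact h0
  · fin_cases j
    · exact ((hu' 0).2.trans one_lt_two).le
    · exact ((hu' 1).2.trans one_lt_two).le
    · exact ((hu' 2).2.trans one_lt_two).le
    · exact (h1.trans hlt.le)

/-! #### Moves (3) + (1a): `[A₁, q·w₃] ≡ [Z, q(1 − u₀² − u₁²)/(2((1 − u₂)² + u₂²))]` -/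

/-- **Moves (3) + (1a):** Newton–Leibniz along `w₃` with the primitive `q·w₃²/2` over `Z`
(closed fibres `[0, b(u)]`), then opening the fibres:
`[A₁, q·w₃] − [Z, q(1 − u₀² − u₁²)/(2((1 − u₂)² + u₂²))] ∈ KZ.relations`.
[KontsevichZagier2001 §1.2 rules (1), (3)] -/
theorem of_srcRep_sub_of_cylWRep_mem_relations (q : ℚ) :
    KZ.of (srcRep q) - KZ.of (cylWRep q) ∈ KZ.relations := by
  have hBs := isSemialgebraic_cylSet
  have ha : IsSemialgebraicFunOn ℚ cylSet (fun _ => (0:ℝ)) := by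
    simpa using isSemialgebraicFunOn_ratCast hBs 0
  have hb : IsSemialgebraicFunOn ℚ cylSet bEdge := isSemialgebraicFunOn_bEdge
  have hband : IsSemialgebraic ℚ (KZlog.band cylSet (fun _ => (0:ℝ)) bEdge) :=
    KZlog.isSemialgebraic_band ha hb
  have hbdry : ∀ u ∈ cylSet,
      (q : ℝ) / 2 * (Fin.snoc u (bEdge u) : Fin 4 → ℝ) (Fin.last 3) ^ 2 -
        (q : ℝ) / 2 * (Fin.snoc u ((fun _ => (0:ℝ)) u) : Fin 4 → ℝ) (Fin.last 3) ^ 2 =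
      (cylWRep q).integrand u := by
    intro u hu
    simp only [Fin.snoc_last, cylWRep_integrand]
    rw [bEdge_sq hu]
    have hG := (gq_pos (u 2)).ne'
    field_simp
    ring
  obtain ⟨rb, rd, hrbd, hrbi, hrdd, hrdi, hrel⟩ := KZ.exists_band_newtonLeibniz hBs
    (fun _ => (0:ℝ)) bEdge ha hb (fun _ _ => Real.sqrt_nonneg _)
    (fun z => (q : ℝ) / 2 * z (Fin.last 3) ^ 2) (fun z => (q : ℝ) * z (Fin.last 3))
    ((isSemialgebraicFunOn_aeval hband (C (q / 2) * X (Fin.last 3) ^ 2)).congr fun z _ => by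
      simp)
    ((isSemialgebraicFunOn_aeval hband (C q * X (Fin.last 3))).congr fun z _ => by simp)
    (fun x _ => by
      simp only [Fin.snoc_last]
      exact (continuous_const.mul (continuous_pow 2)).continuousOn)
    (fun x _ t _ => by
      simp only [Fin.snoc_last]
      exact ((hasDerivAt_pow 2 t).const_mul ((q : ℝ) / 2)).congr_deriv (by ring))
    (((continuous_const.mul (continuous_apply _)).continuousOn.integrableOn_compact
      isCompact_Icc).mono_set band_cylSet_subset_Icc)
    ((cylWRep q).isSemialgebraicFunOn_integrand.congr fun u hu => (hbdry u hu).symm)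
    (((cylWRep q).integrableOn.congr_fun (fun u hu => (hbdry u hu).symm)
      isSemialgebraic_cylSet.measurableSet_holds))
  obtain ⟨rb', hrb'd, hrb'i, hrel'⟩ := KZ.of_sub_of_restrict_openBand_mem_relations ha hb rb hrbd
  have hpin1 : KZ.of rb' - KZ.of (srcRep q) ∈ KZ.relations := by
    refine KZ.of_sub_of_mem_relations_of_eqOn ?_ fun z _ => ?_
    · rw [hrb'd, srcRep_domain]
      ext z
      exact mem_srcSet_iff_init z
    · rw [hrb'i, hrbi]
      rfl
  have hpin2 : KZ.of rd - KZ.of (cylWRep q) ∈ KZ.relations := by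
    refine KZ.of_sub_of_mem_relations_of_eqOn ?_ fun u hu => ?_
    · rw [cylWRep_domain, hrdd]
    · rw [hrdi]
      rw [hrdd] at hu
      exact hbdry u hu
  have : KZ.of (srcRep q) - KZ.of (cylWRep q) =
      (KZ.of rb - KZ.of rd) - (KZ.of rb - KZ.of rb') - (KZ.of rb' - KZ.of (srcRep q)) +
        (KZ.of rd - KZ.of (cylWRep q)) := by abel
  rw [this]
  exact add_mem (sub_mem (sub_mem hrel hrel') hpin1) hpin2

/-- **`[ball-orthant cell, q] ≡ [Z, q(1 − u₀² − u₁²)/(2((1 − u₂)² + u₂²))]`** (`4 → 3`: the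
orthant of the unit 4-ball descends to a rational weight on the quarter-cylinder Walsh 3-cell).
[KontsevichZagier2001 §1.2; this node] -/
theorem of_cell_sub_of_cylWRep_mem_relations (q : ℚ) :
    KZ.of (cellRep ball4Poly q) - KZ.of (cylWRep q) ∈ KZ.relations := by
  have h1 := of_srcRep_sub_of_cell_mem_relations q
  have h2 := of_srcRep_sub_of_cylWRep_mem_relations q
  have : KZ.of (cellRep ball4Poly q) - KZ.of (cylWRep q) =
      (KZ.of (srcRep q) - KZ.of (cylWRep q)) - (KZ.of (srcRep q) - KZ.of (cellRep ball4Poly q)) := by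
    abel
  rw [this]
  exact sub_mem h2 h1

end Summit.KontsevichZagierPeriods.RootDecompWalshStrata.Ball4

end
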